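import Mathlib
import HarnessLib
import Summits.NavierStokesRegularity.NavierStokesRegularity.Theorems.WakeRatchetMinimalViscousBlowupUpperBlock
import Summits.NavierStokesRegularity.NavierStokesRegularity.Theorems.WakeRatchetMinimalViscousBlowupEveryShellFires

/-!
# Route `WakeRatchet`, crux `MinimalViscousBlowup` (stmt-NavierStokesRegularity-22743) — LINE g12-2 (ns-idea-1 g12, card «monotone quantity hunt»):
# RE-IGNITION, part 3/5 — a shell whose upper block is dark must fire again before the blow-up

ns-idea-1 g12's kernel-checked file `lines/g12-2/Reignition.lean` (sha16 d946145192243467, 872 l.; evidence on ⟨22743⟩), landed VERBATIM by the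
hand ns-qj-p1 g7 in five tree-sized files (decl texts byte-identical; only the module docstrings are split):
`…ShellFence` (§1–§2) · `…UpperBlock` (§3) · `…Reignition` (§4) · `…LevelGrowth` (§5) · `…RetreatDepth` (§6).
MODEL lattice only (Tao's NS-scaled `ν`-viscous cascade lattice, `m = 4`; nothing about Navier–Stokes; no NS regularity statement is proved).
`--supports stmt-NavierStokesRegularity-22743 --as helper`.

* `reignition` — along an enveloped blow-up, if at time `s` every shell above `k` is dark (`≤ cν²/2`, `c ≤ 1/(16384λ¹⁹)` structural), then shell
  `k` itself exceeds `cν²` at some time in `[s,T)`: otherwise the block above `k` is trapped (`upperBlock_maxPrinciple`), then shell by shell its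
  levels obey `B_{j+1} = max(level at s, 16384 B_j²/ν²)`, which inherits the `λ^{−19n}` decay of the (regular) time-`s` data from some shell on,
  so the weight-10 norm stays bounded on `[s,T)` — no blow-up.  (The tree's `everyShellFires` is the time-`0` statement, empty data above.)
  The proof needs `maxHeartbeats 800000` (as in the author's file).
[cite: Tao2016AveragedNS, §4 (4.1)–(4.3), Lemma 4.1 (4.5), §5; BarbatoMorandinRomito2011, §3.1]
-/

noncomputable section

set_option linter.dupNamespace false

open Set Filter Topology
open Literature.Analysis.FluidPDE Literature.Analysis.FluidPDE.TaoCascade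

namespace Summit.NavierStokesRegularity.NavierStokesRegularity.Theorems.MinimalViscousBlowup.ThresholdRay

/-! ### §4 Re-ignition -/

set_option maxHeartbeats 800000 in
/-- **RE-IGNITION.**  `λ = 1+ε₀`, a cancelling table with `|α_{··(0,0,1)}| ≤ 1`, a regular trajectory of the NS-scaled `ν`-viscous cascade
lattice on `[0,T)` (no shells below `0`, weight-10 bound on every `[0,T']`) which BLOWS UP at `T` under a critical envelope `λⁿ‖X_n‖² ≤ C`, a
structural darkness level `0 < c ≤ 1/(16384λ¹⁹)`.  If at a time `s < T` every shell ABOVE `k` is dark (`λᵐ‖X_m(s)‖² ≤ cν²/2` for `m > k`), then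
shell `k` exceeds the level `cν²` at some time in `[s,T)`.  Otherwise shell `k` is a closed valve from `s` on with dark data above: the block above
stays `≤ cν²` (`upperBlock_maxPrinciple`); shell by shell (`shell_fence`) its levels obey `B_{j+1} = max(λ^{k+j+1}‖X_{k+j+1}(s)‖², 16384B_j²/ν²)`,
which from some shell on inherits the `λ^{−19m}` decay of the (regular) data at time `s`; so the weight-10 norm stays bounded on `[s,T)` — no
blow-up.  (`everyShellFires` is the case `s = 0`, empty data above.)  MODEL lattice only.
[cite: Tao2016AveragedNS, §4 (4.3), Lemma 4.1 (4.5), §5; BarbatoMorandinRomito2011, §3.1] -/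
theorem reignition {ε₀ ν T C c s : ℝ} (hε : 0 < ε₀) (hν : 0 < ν) (hT : 0 < T)
    {α : Fin 4 → Fin 4 → Fin 4 → ℤ × ℤ × ℤ → ℝ} (hcan : IsCancellingCoeff α)
    (hα1 : ∀ i₁ i₂ i₃, |α i₁ i₂ i₃ (0, 0, 1)| ≤ 1) {X : Fin 4 → ℤ → ℝ → ℝ}
    (hcd : ∀ i n, ContDiffOn ℝ 1 (X i n) (Ico 0 T))
    (hlow : ∀ i n t, n < 0 → X i n t = 0)
    (hmot : ∀ i n t, 0 ≤ t → t < T → derivWithin (X i n) (Ici 0) t =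
      quadTerm ε₀ α X i n t - ν * (1 + ε₀) ^ ((2 : ℝ) * n) * X i n t)
    (hreg : ∀ T' : ℝ, 0 < T' → T' < T → ∃ M : ℝ, ∀ t : ℝ, 0 ≤ t → t ≤ T' →
      ∀ (i : Fin 4) (n : ℤ), (1 + (1 + ε₀) ^ ((10 : ℝ) * n)) * |X i n t| ≤ M)
    (hblow : ∀ M : ℝ, ∃ t : ℝ, 0 ≤ t ∧ t < T ∧
      ∃ (i : Fin 4) (n : ℤ), M < (1 + (1 + ε₀) ^ ((10 : ℝ) * n)) * |X i n t|)
    (henv : ∀ (n : ℤ) (t : ℝ), 0 ≤ t → t < T → (1 + ε₀) ^ n * ‖shellVec X n t‖ ^ 2 ≤ C)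
    (hc0 : 0 < c) (hc1 : c ≤ 1 / (16384 * (1 + ε₀) ^ 19))
    (hs0 : 0 ≤ s) (hsT : s < T) {k : ℕ}
    (hdark : ∀ m : ℕ, k < m → (1 + ε₀) ^ m * ‖shellVec X m s‖ ^ 2 ≤ c / 2 * ν ^ 2) :
    ∃ t, s ≤ t ∧ t < T ∧ c * ν ^ 2 < (1 + ε₀) ^ k * ‖shellVec X k t‖ ^ 2 := by
  have hl0 : (0 : ℝ) < 1 + ε₀ := by linarith
  have hl1 : (1 : ℝ) < 1 + ε₀ := by linarith
  by_contra hno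
  push Not at hno
  -- constants
  have h19 : (1 : ℝ) < (1 + ε₀) ^ 19 := one_lt_pow₀ hl1 (by norm_num)
  have hP19 : (0 : ℝ) < (1 + ε₀) ^ 19 := by positivity
  set θ : ℝ := ((1 + ε₀) ^ 19)⁻¹ with hθ
  have hθ0 : 0 < θ := by rw [hθ]; positivity
  have hθ1 : θ ≤ 1 := by rw [hθ]; exact inv_le_one_of_one_le₀ h19.le
  have hcθ : 16384 * c ≤ θ := by
    rw [hθ, ← one_div]
    have := (le_div_iff₀ (by positivity : (0 : ℝ) < 16384 * (1 + ε₀) ^ 19)).1 hc1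
    rw [le_div_iff₀ hP19]
    linarith
  have hc16 : 16384 * c ≤ 1 := hcθ.trans hθ1
  have hθP : θ * (1 + ε₀) ^ 19 = 1 := by rw [hθ, inv_mul_cancel₀ hP19.ne']
  clear_value θ
  have hν2 : 0 < ν ^ 2 := pow_pos hν 2
  set L₁ : ℝ := c * ν ^ 2 with hL₁def
  set L₀ : ℝ := c / 2 * ν ^ 2 with hL₀def
  have hL₁0 : 0 < L₁ := by positivity
  have hL₀0 : 0 ≤ L₀ := by positivity
  have hL₀₁ : L₀ < L₁ := by rw [hL₀def, hL₁def]; nlinarith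
  have hL₁ : L₁ < ν ^ 2 / 16384 := by
    rw [hL₁def, lt_div_iff₀ (by norm_num)]
    have : c < 1 / 16384 := by
      have h2 : 1 / (16384 * (1 + ε₀) ^ 19) < 1 / 16384 := by
        apply one_div_lt_one_div_of_lt (by norm_num); nlinarith
      exact lt_of_le_of_lt hc1 h2
    nlinarith
  have hKL₁ : max L₀ (16384 * L₁ ^ 2 / ν ^ 2) ≤ L₁ := by
    refine max_le hL₀₁.le ?_
    rw [div_le_iff₀ hν2, hL₁def]
    have : 16384 * (c * ν ^ 2) ^ 2 = (16384 * c) * ((c * ν ^ 2) * ν ^ 2) := by ring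
    rw [this]
    exact mul_le_of_le_one_left (by positivity) hc16
  -- Stage 1: the block above `k` is trapped below `L₁` on `[s,T)`
  have hblock : ∀ τ, s ≤ τ → τ < T → ∀ m : ℕ, k < m → (1 + ε₀) ^ m * ‖shellVec X m τ‖ ^ 2 ≤ L₁ := by
    intro τ hsτ hτT m hkm
    have h := upperBlock_maxPrinciple hε hν hcan hα1 hcd hmot hreg hs0 hsτ hτT hL₀0 hL₀₁ hL₁
      (fun τ' h1 h2 => hno τ' h1 (lt_of_le_of_lt h2 hτT)) hdark τ hsτ le_rfl m hkm
    exact h.trans hKL₁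
  -- Stage 2: the recursion `B`
  obtain ⟨B, hB0, hBs⟩ : ∃ B : ℕ → ℝ, B 0 = c * ν ^ 2 ∧ ∀ j, B (j + 1) =
      max ((1 + ε₀) ^ (k + j + 1) * ‖shellVec X ((k + j + 1 : ℕ) : ℤ) s‖ ^ 2) (16384 * B j ^ 2 / ν ^ 2) :=
    ⟨fun j => Nat.rec (motive := fun _ => ℝ) (c * ν ^ 2)
      (fun j Bj => max ((1 + ε₀) ^ (k + j + 1) * ‖shellVec X ((k + j + 1 : ℕ) : ℤ) s‖ ^ 2) (16384 * Bj ^ 2 / ν ^ 2)) j,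
      rfl, fun _ => rfl⟩
  have hBnn : ∀ j, 0 ≤ B j := by
    intro j
    cases j with
    | zero => rw [hB0]; positivity
    | succ j => rw [hBs]; exact le_trans (by positivity) (le_max_right _ _)
  have hBle : ∀ j, B j ≤ c * ν ^ 2 := by
    intro j
    induction j with
    | zero => rw [hB0]
    | succ j ih =>
      rw [hBs]
      refine max_le ((hdark (k + j + 1) (by omega)).trans (by nlinarith)) ?_
      rw [div_le_iff₀ hν2]
      have h1 : B j ^ 2 ≤ (c * ν ^ 2) * B j := by nlinarith [hBnn j]
      calc 16384 * B j ^ 2 ≤ 16384 * ((c * ν ^ 2) * B j) := by linarith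
        _ = (16384 * c) * (B j * ν ^ 2) := by ring
        _ ≤ 1 * ((c * ν ^ 2) * ν ^ 2) := by
            exact mul_le_mul hc16 (mul_le_mul_of_nonneg_right ih hν2.le) (mul_nonneg (hBnn j) hν2.le) zero_le_one
        _ = c * ν ^ 2 * ν ^ 2 := one_mul _
  have hP : ∀ j : ℕ, ∀ t, s ≤ t → t < T → (1 + ε₀) ^ (k + j) * ‖shellVec X ((k + j : ℕ) : ℤ) t‖ ^ 2 ≤ B j := by
    intro j
    induction j with
    | zero =>
      intro t hst htT
      rw [hB0, Nat.add_zero]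
      exact hno t hst htT
    | succ j ih =>
      intro t hst htT
      -- the window `[0,T']`, `T' = (t+T)/2`
      set T' : ℝ := (t + T) / 2 with hT'
      have htT' : t < T' := by rw [hT']; linarith
      have hT'T : T' < T := by rw [hT']; linarith
      have hder := hasDerivWithinAt_window_of_clauses (ε₀ := ε₀) (ν := ν) (α := α) hcd hmot hT'T
      have hF : 16384 * B j ^ 2 ≤ ν ^ 2 * B (j + 1) :=
        calc 16384 * B j ^ 2 = ν ^ 2 * (16384 * B j ^ 2 / ν ^ 2) := by field_simp
          _ ≤ ν ^ 2 * B (j + 1) := by rw [hBs]; exact mul_le_mul_of_nonneg_left (le_max_right _ _) hν2.le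
      have hlo : ∀ τ ∈ Icc s t, (1 + ε₀) ^ (k + j) * ‖shellVec X ((k + j : ℕ) : ℤ) τ‖ ^ 2 ≤ B j :=
        fun τ hτ => ih τ hτ.1 (lt_of_le_of_lt hτ.2 htT)
      have hup : ∀ τ ∈ Icc s t, (1 + ε₀) ^ (k + j + 2) * ‖shellVec X ((k + j + 2 : ℕ) : ℤ) τ‖ ^ 2 ≤ L₁ :=
        fun τ hτ => hblock τ hτ.1 (lt_of_le_of_lt hτ.2 htT) (k + j + 2) (by omega)
      have h0 : (1 + ε₀) ^ (k + j + 1) * ‖shellVec X ((k + j + 1 : ℕ) : ℤ) s‖ ^ 2 ≤ B (j + 1) := by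
        rw [hBs]; exact le_max_left _ _
      have hres := shell_fence hε hν hcan hα1 hder hs0 htT' (hBnn j) hL₁0.le hL₁ hF hlo hup h0 t ⟨hst, le_rfl⟩
      have e : k + (j + 1) = k + j + 1 := rfl
      rw [e]
      exact hres
  -- Stage 3: the data at time `s` decay like `λ^{-19m}`, hence so does `B` from some shell on
  obtain ⟨M₀, hM₀⟩ := hreg ((s + T) / 2) (by linarith) (by linarith)
  set M : ℝ := max M₀ 0 with hMdef
  have hM0 : 0 ≤ M := le_max_right _ _
  have hM : ∀ t, 0 ≤ t → t ≤ (s + T) / 2 → ∀ (i : Fin 4) (n : ℤ),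
      (1 + (1 + ε₀) ^ ((10 : ℝ) * n)) * |X i n t| ≤ M :=
    fun t h0 h1 i n => (hM₀ t h0 h1 i n).trans (le_max_left _ _)
  clear_value M
  have hdecay : ∀ m : ℕ, (1 + ε₀) ^ (19 * m) * ((1 + ε₀) ^ m * ‖shellVec X m s‖ ^ 2) ≤ 4 * M ^ 2 := by
    intro m
    have hPm : (0 : ℝ) < (1 + ε₀) ^ (10 * m) := pow_pos hl0 _
    have hX : ∀ i : Fin 4, |X i m s| ≤ M / (1 + ε₀) ^ (10 * m) := by
      intro i
      have h := hM s hs0 (by linarith) i m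
      have hw : (1 + ε₀) ^ ((10 : ℝ) * ((m : ℕ) : ℤ)) = (1 + ε₀) ^ (10 * m) := by
        rw [show ((10 : ℝ) * (((m : ℕ) : ℤ) : ℝ)) = ((10 * m : ℕ) : ℝ) by push_cast; ring, Real.rpow_natCast]
      rw [hw] at h
      rw [le_div_iff₀ hPm]
      nlinarith [abs_nonneg (X i m s)]
    have hn := norm_shellVec_le_two_mul (by positivity) hX
    have hsq : ‖shellVec X m s‖ ^ 2 ≤ (2 * (M / (1 + ε₀) ^ (10 * m))) ^ 2 :=
      pow_le_pow_left₀ (norm_nonneg _) hn 2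
    calc (1 + ε₀) ^ (19 * m) * ((1 + ε₀) ^ m * ‖shellVec X m s‖ ^ 2)
        ≤ (1 + ε₀) ^ (19 * m) * ((1 + ε₀) ^ m * (2 * (M / (1 + ε₀) ^ (10 * m))) ^ 2) := by gcongr
      _ = 4 * M ^ 2 := by
          have hne : (1 + ε₀) ^ (10 * m) ≠ 0 := hPm.ne'
          field_simp
          ring
  -- the shell `n₁ = k + j₁` from which the data lie below `cν² λ^{19 n₁} λ^{-19 m}`
  obtain ⟨n, hn⟩ := pow_unbounded_of_one_lt (4 * M ^ 2 / (c * ν ^ 2)) h19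
  set j₁ : ℕ := n + 1 with hj₁
  set n₁ : ℕ := k + j₁ with hn₁
  have hdata : 4 * M ^ 2 ≤ c * ν ^ 2 * ((1 + ε₀) ^ 19) ^ n₁ := by
    rw [div_lt_iff₀ hL₁0] at hn
    have hpow : ((1 + ε₀) ^ 19) ^ n ≤ ((1 + ε₀) ^ 19) ^ n₁ := pow_le_pow_right₀ h19.le (by omega)
    calc 4 * M ^ 2 ≤ ((1 + ε₀) ^ 19) ^ n * (c * ν ^ 2) := hn.le
      _ ≤ ((1 + ε₀) ^ 19) ^ n₁ * (c * ν ^ 2) := mul_le_mul_of_nonneg_right hpow hL₁0.le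
      _ = c * ν ^ 2 * ((1 + ε₀) ^ 19) ^ n₁ := mul_comm _ _
  have hBdec : ∀ a : ℕ, B (j₁ + a) ≤ c * ν ^ 2 * θ ^ a := by
    intro a
    induction a with
    | zero => rw [pow_zero, mul_one, Nat.add_zero]; exact hBle j₁
    | succ a ih =>
      rw [show j₁ + (a + 1) = (j₁ + a) + 1 from rfl, hBs]
      refine max_le ?_ ?_
      · -- the data term
        set m : ℕ := k + (j₁ + a) + 1 with hm
        have hd := hdecay m
        have hsplit : (1 + ε₀) ^ (19 * m) = ((1 + ε₀) ^ 19) ^ n₁ * ((1 + ε₀) ^ 19) ^ (a + 1) := by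
          rw [← pow_add, ← pow_mul]; congr 1; rw [hm, hn₁]; ring
        have hPa : (0 : ℝ) < ((1 + ε₀) ^ 19) ^ (a + 1) := by positivity
        have hθa : θ ^ (a + 1) * ((1 + ε₀) ^ 19) ^ (a + 1) = 1 := by rw [← mul_pow, hθP, one_pow]
        -- `λ^{19 n₁} λ^{19(a+1)} ℓ ≤ 4M² ≤ cν² λ^{19 n₁}`
        have h1 : ((1 + ε₀) ^ 19) ^ n₁ * (((1 + ε₀) ^ 19) ^ (a + 1) *
            ((1 + ε₀) ^ m * ‖shellVec X (m : ℤ) s‖ ^ 2)) ≤ ((1 + ε₀) ^ 19) ^ n₁ * (c * ν ^ 2) := by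
          have := hd; rw [hsplit] at this; nlinarith
        have h2 : ((1 + ε₀) ^ 19) ^ (a + 1) * ((1 + ε₀) ^ m * ‖shellVec X (m : ℤ) s‖ ^ 2) ≤ c * ν ^ 2 :=
          le_of_mul_le_mul_left h1 (by positivity)
        calc (1 + ε₀) ^ m * ‖shellVec X (m : ℤ) s‖ ^ 2
            = θ ^ (a + 1) * (((1 + ε₀) ^ 19) ^ (a + 1) * ((1 + ε₀) ^ m * ‖shellVec X (m : ℤ) s‖ ^ 2)) := by
              rw [← mul_assoc, hθa, one_mul]
          _ ≤ θ ^ (a + 1) * (c * ν ^ 2) := mul_le_mul_of_nonneg_left h2 (by positivity)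
          _ = c * ν ^ 2 * θ ^ (a + 1) := by ring
      · -- the recursion term: `16384 B² / ν² ≤ 16384 c B ≤ θ B`
        rw [div_le_iff₀ hν2]
        have hBj := hBnn (j₁ + a)
        have h1 : B (j₁ + a) ^ 2 ≤ (c * ν ^ 2 * θ ^ a) * B (j₁ + a) := by nlinarith
        calc 16384 * B (j₁ + a) ^ 2 ≤ 16384 * ((c * ν ^ 2 * θ ^ a) * B (j₁ + a)) := by linarith
          _ = (16384 * c) * B (j₁ + a) * (ν ^ 2 * θ ^ a) := by ring
          _ ≤ θ * (c * ν ^ 2) * (ν ^ 2 * θ ^ a) := by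
              apply mul_le_mul_of_nonneg_right _ (by positivity)
              exact mul_le_mul hcθ (hBle _) hBj hθ0.le
          _ = c * ν ^ 2 * θ ^ (a + 1) * ν ^ 2 := by rw [pow_succ]; ring
  -- the levels of the shells `≥ n₁` on `[s,T)`
  have hhigh : ∀ (a : ℕ) (t : ℝ), s ≤ t → t < T →
      ((1 + ε₀) ^ (10 * (n₁ + a)) * ‖shellVec X ((n₁ + a : ℕ) : ℤ) t‖) ^ 2 ≤ c * ν ^ 2 * ((1 + ε₀) ^ 19) ^ n₁ := by
    intro a t hst htT
    have h1 := hP (j₁ + a) t hst htT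
    have hidx : k + (j₁ + a) = n₁ + a := by rw [hn₁]; ring
    rw [hidx] at h1
    have h2 := h1.trans (hBdec a)
    -- `λ^{20(n₁+a)} ‖X‖² = λ^{19(n₁+a)} · ℓ ≤ λ^{19(n₁+a)} cν² θ^a = cν² λ^{19 n₁}`
    have hθa : θ ^ a * ((1 + ε₀) ^ 19) ^ a = 1 := by rw [← mul_pow, hθP, one_pow]
    have hv := sq_nonneg ‖shellVec X ((n₁ + a : ℕ) : ℤ) t‖
    calc ((1 + ε₀) ^ (10 * (n₁ + a)) * ‖shellVec X ((n₁ + a : ℕ) : ℤ) t‖) ^ 2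
        = ((1 + ε₀) ^ 19) ^ n₁ * (((1 + ε₀) ^ 19) ^ a *
            ((1 + ε₀) ^ (n₁ + a) * ‖shellVec X ((n₁ + a : ℕ) : ℤ) t‖ ^ 2)) := by
          rw [← pow_mul, ← pow_mul]; ring
      _ ≤ ((1 + ε₀) ^ 19) ^ n₁ * (((1 + ε₀) ^ 19) ^ a * (c * ν ^ 2 * θ ^ a)) := by gcongr
      _ = c * ν ^ 2 * ((1 + ε₀) ^ 19) ^ n₁ * (θ ^ a * ((1 + ε₀) ^ 19) ^ a) := by ring
      _ = c * ν ^ 2 * ((1 + ε₀) ^ 19) ^ n₁ := by rw [hθa, mul_one]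
  -- Stage 4: a uniform weight-10 bound on `[0,T)`, contradicting the blow-up
  have hC0 : 0 ≤ C := le_trans (by positivity) (henv 0 0 le_rfl hT)
  set B₁ : ℝ := Real.sqrt (c * ν ^ 2 * ((1 + ε₀) ^ 19) ^ n₁) with hB₁
  have hB₁0 : 0 ≤ B₁ := by rw [hB₁]; positivity
  set W : ℝ := 2 * (1 + ε₀) ^ (10 * n₁) * Real.sqrt C + 2 * B₁ + M + 1 with hW
  obtain ⟨t, ht0, htT, i, q, hq⟩ := hblow W
  have hbound : (1 + (1 + ε₀) ^ ((10 : ℝ) * q)) * |X i q t| ≤ 2 * (1 + ε₀) ^ (10 * n₁) * Real.sqrt C + 2 * B₁ + M := by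
    have hsC : 0 ≤ Real.sqrt C := Real.sqrt_nonneg C
    have hbig : 0 ≤ 2 * (1 + ε₀) ^ (10 * n₁) * Real.sqrt C + 2 * B₁ := by positivity
    rcases le_or_gt t s with hts | hts
    · -- before `s`: the weight-10 bound `M`
      have := hM t ht0 (by linarith) i q
      linarith
    · rcases lt_or_ge q 0 with hqneg | hq0
      · rw [hlow i q t hqneg, abs_zero, mul_zero]; positivity
      · obtain ⟨q', rfl⟩ := Int.eq_ofNat_of_zero_le hq0
        have hw : (1 + ε₀) ^ ((10 : ℝ) * ((q' : ℕ) : ℤ)) = (1 + ε₀) ^ (10 * q') := by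
          rw [show ((10 : ℝ) * (((q' : ℕ) : ℤ) : ℝ)) = ((10 * q' : ℕ) : ℝ) by push_cast; ring, Real.rpow_natCast]
        rw [hw]
        have habs := abs_apply_le_norm_shellVec X q' t i
        have hw1 : (1 : ℝ) ≤ (1 + ε₀) ^ (10 * q') := one_le_pow₀ hl1.le
        rcases lt_or_ge q' n₁ with hlt | hge
        · -- below `n₁`: the envelope
          have he := henv q' t ht0 htT
          rw [zpow_natCast] at he
          have hk1 : (1 : ℝ) ≤ (1 + ε₀) ^ q' := one_le_pow₀ hl1.le
          have hn2 : ‖shellVec X (q' : ℤ) t‖ ^ 2 ≤ C := by nlinarith [sq_nonneg ‖shellVec X (q' : ℤ) t‖]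
          have hnC : ‖shellVec X (q' : ℤ) t‖ ≤ Real.sqrt C := (Real.le_sqrt (norm_nonneg _) hC0).2 hn2
          have hwk : (1 + ε₀) ^ (10 * q') ≤ (1 + ε₀) ^ (10 * n₁) := pow_le_pow_right₀ hl1.le (by omega)
          calc (1 + (1 + ε₀) ^ (10 * q')) * |X i (q' : ℤ) t|
              ≤ (2 * (1 + ε₀) ^ (10 * n₁)) * Real.sqrt C :=
                mul_le_mul (by linarith) (habs.trans hnC) (abs_nonneg _) (by positivity)
            _ ≤ 2 * (1 + ε₀) ^ (10 * n₁) * Real.sqrt C + 2 * B₁ + M := by linarith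
        · -- at or above `n₁`: the trapped, decaying shells
          obtain ⟨a, rfl⟩ := Nat.exists_eq_add_of_le hge
          have hsq := hhigh a t hts.le htT
          have hB₁sq : B₁ ^ 2 = c * ν ^ 2 * ((1 + ε₀) ^ 19) ^ n₁ := by
            rw [hB₁, Real.sq_sqrt (by positivity)]
          have hle : (1 + ε₀) ^ (10 * (n₁ + a)) * ‖shellVec X ((n₁ + a : ℕ) : ℤ) t‖ ≤ B₁ :=
            (pow_le_pow_iff_left₀ (by positivity) hB₁0 two_ne_zero).1 (by rw [hB₁sq]; exact hsq)
          calc (1 + (1 + ε₀) ^ (10 * (n₁ + a))) * |X i ((n₁ + a : ℕ) : ℤ) t|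
              ≤ (2 * (1 + ε₀) ^ (10 * (n₁ + a))) * ‖shellVec X ((n₁ + a : ℕ) : ℤ) t‖ :=
                mul_le_mul (by linarith) habs (abs_nonneg _) (by positivity)
            _ = 2 * ((1 + ε₀) ^ (10 * (n₁ + a)) * ‖shellVec X ((n₁ + a : ℕ) : ℤ) t‖) := by ring
            _ ≤ 2 * B₁ := by linarith
            _ ≤ 2 * (1 + ε₀) ^ (10 * n₁) * Real.sqrt C + 2 * B₁ + M := by
                have : 0 ≤ 2 * (1 + ε₀) ^ (10 * n₁) * Real.sqrt C := by positivity
                linarith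
  have : W ≤ 2 * (1 + ε₀) ^ (10 * n₁) * Real.sqrt C + 2 * B₁ + M := hq.le.trans hbound
  rw [hW] at this
  linarith

end Summit.NavierStokesRegularity.NavierStokesRegularity.Theorems.MinimalViscousBlowup.ThresholdRay

end
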